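import Summits.QuantumFields.YangMills.Theorems.SusceptibilityToPoincare.Negative.Bottleneck
import Literature.MathematicalPhysics.QuantumFieldTheory.YangMillsOS
import Literature.MathematicalPhysics.QuantumFieldTheory.TwistSectorInputs

/-!
# `SusceptibilityToPoincare` — negative lemma modulo `TwistSectorInputs` ('t Hooft twist sectors of centreless `G`)

Crux `stmt-QuantumFields-9441` (`Summit.QuantumFields.YangMills.Theses.FradkinShenkerFlow.SusceptibilityToPoincare`):
for every compact simple `G` (`IsCompactSimpleLieGroup`: connected, non-abelian, no proper non-trivial closed connected
normal subgroup, with a faithful unitary lattice representation — this ADMITS the centreless, non-simply-connected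
groups SO(3), PSU(N), …), every `r`, `β ≥ 0`: FS(r, β) ⇒ UP(r, β). From the standing disprover's work file
`Cruxes/SusceptibilityToPoincare/Disproof.lean` §§2–3 (cycle 1).

`SusceptibilityToPoincare_false_of_TwistSectorInputs : Literature.MathematicalPhysics.QuantumFieldTheory.TwistSectorInputs → ¬ SusceptibilityToPoincare` — the crux is
false MODULO the hypothesis `H = Literature.MathematicalPhysics.QuantumFieldTheory.TwistSectorInputs`: some admissible, NOT simply connected `G`, some `r` and `β ≥ 0`
with (i) FS(r, β), carrying GAUGE-INVARIANT measurable events `A S` on the tori of sides `2S+1` with (ii) Wilson mass in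
`[δ, 1 − δ]` and (iii) single-link heat-bath boundary flux `→ 0`; the kill is the bottleneck lemma
`not_uniformHeatBathPoincare_of_bottleneck`. The SAME `H` kills the scope sentinel `stub_fsPoincareInv_nonSimplyConnected`
of line `orbit-slice-reduction` (`stub_fsPoincareInv_nonSimplyConnected_false_of_TwistSectorInputs`).

Intended inhabitant of `H` (paper; Disproof.lean §2): `G = SO(3)`, `r = ρ₃`, `β > β₁`, `A S = {w₁₂ = 1} ∩ Ω_good(S)`,
`w ∈ H²(T⁴; π₁ SO(3)) = ℤ₂⁶` the 't Hooft MAGNETIC TWIST of the configuration, defined away from ℤ₂-monopole clusters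
of diameter `> S/4`: (iii) is rigorous on paper — `w` is EXACTLY conserved by single-link updates inside `Ω_good`
(the difference cochain lives on `star(ℓ)`, whose cube–plaquette incidence graph `K_{2,2,2}` is connected), the heat-bath
pair `(U, U[ℓ ↦ g])` is exchangeable (PROVED: `Negative/ConservedEventFlux.lean`, `lintegral_heatBath_update`,
`hbForm_indicator_le_of_conserved`), and the boundary `∂Ω_good` is a large-field event of chessboard/Peierls mass
`≤ poly(S)(K e^{−cβ})^{S/48}`; (ii) ("magnetic flux stays light", `Z_tw/Z_untw ↛ 0`) and (i) (finite susceptibility of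
SO(3)₄ at weak coupling) are the expected-but-unproved physics of the confined phase ('t Hooft 1979 flux duality;
de Forcrand–Jahn 2003 §5: Metropolis is non-ergodic across SO(3) twist sectors beyond `4⁴`, the barrier growing with the
size; Burgio et al. 2006: twists `±1` per configuration at weak coupling, `F → 0` as `T → 0`). So the crux as typed
asserts for SO(3) that finite susceptibility forces twist-sector PURITY (a magnetically Higgsed vacuum).
Class if `H` is ever inhabited: refuted-misstated; repaired statement C′ = the crux with `SimplyConnectedSpace G` added
(stub 4a of the line); for π₁(G) = 0 and faithful `r` every non-zero twist class has mass `e^{−cβS²}`, so the witness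
misses C′. Nothing here asserts a Theses statement; `TwistSectorInputs` is the one new `Prop` (self-contained, for
relocation to Literature by the gate).
-/

noncomputable section

namespace Summit.QuantumFields.YangMills.Theorems.SusceptibilityToPoincare.Negative

open MeasureTheory ProbabilityTheory Filter Topology
open Literature.MathematicalPhysics.QuantumFieldTheory

/-- **`¬ SusceptibilityToPoincare` modulo `TwistSectorInputs`.** If some centreless compact simple `G` carries
gauge-invariant events of non-degenerate Wilson mass with vanishing single-link heat-bath flux at a coupling where FS
holds — the expected weak-coupling physics of the 't Hooft twist sectors of SO(3)₄ — then the crux AS TYPED is false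
(bottleneck lemma `not_uniformHeatBathPoincare_of_bottleneck`). Composing with an inhabitant of `H` is the real
refutation (class refuted-misstated; repair: add `SimplyConnectedSpace G`). [folklore] -/
theorem SusceptibilityToPoincare_false_of_TwistSectorInputs (h : Literature.MathematicalPhysics.QuantumFieldTheory.TwistSectorInputs) :
    ¬ Summit.QuantumFields.YangMills.Theses.FradkinShenkerFlow.SusceptibilityToPoincare := by
  intro hcrux
  obtain ⟨G, _, _, _, _, _, _, hsimple, -, r, β, hβ, hfs, δ, hδ, A, hmeas, -, hmass, hflux⟩ := h
  exact not_uniformHeatBathPoincare_of_bottleneck r β hδ A hmeas hmass hflux (hcrux G hsimple r β hβ hfs)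

/-- **The scope sentinel `stub_fsPoincareInv_nonSimplyConnected` of line `orbit-slice-reduction` (skeleton sha
521baf1b3135; restated verbatim) is false modulo the same `H`**: the witness events are gauge-invariant, so already
the invariant-sector Poincaré inequality UP_inv fails at the witness `(G, r, β)` with FS intact. [folklore] -/
theorem stub_fsPoincareInv_nonSimplyConnected_false_of_TwistSectorInputs (h : Literature.MathematicalPhysics.QuantumFieldTheory.TwistSectorInputs) :
    ¬ ∀ (G : Type) [Group G] [TopologicalSpace G] [IsTopologicalGroup G] [CompactSpace G]
      [MeasurableSpace G] [BorelSpace G], IsCompactSimpleLieGroup G → ¬ SimplyConnectedSpace G →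
      ∀ (r : LatticeRep G) (β : ℝ), 0 ≤ β →
      (∀ A B : YMSpecies G, ∃ χ : ℝ, ∀ S : ℕ, ∑ x ∈ Literature.Probability.LatticeModels.box 4 S,
        |covariance (fun U => A.F (Literature.MathematicalPhysics.QuantumLattice.torusLift (2 * S + 1) U))
          (fun U => B.F (Literature.MathematicalPhysics.QuantumLattice.configShift (-x)
          (Literature.MathematicalPhysics.QuantumLattice.torusLift (2 * S + 1) U)))
          (wilsonMeasure (d := 4) (L := 2 * S + 1) r.ρ β)| ≤ χ) →
      ∃ C : ℝ, ∀ S : ℕ, ∀ F : GaugeConfig 4 (2 * S + 1) G → ℝ, Measurable F → (∃ M : ℝ, ∀ U, |F U| ≤ M) →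
        IsGaugeInvariant F →
        variance F (wilsonMeasure (d := 4) (L := 2 * S + 1) r.ρ β) ≤
          C * ∑ ℓ : Edge 4 (2 * S + 1), ∫ U, ∫ g, (F U - F (Function.update U ℓ g)) ^ 2
            ∂((haarProbability G).tilted (fun g' => -β * wilsonAction r.ρ (Function.update U ℓ g')))
            ∂(wilsonMeasure (d := 4) (L := 2 * S + 1) r.ρ β) := by
  intro hstub
  obtain ⟨G, _, _, _, _, _, _, hsimple, hnsc, r, β, hβ, hfs, δ, hδ, A, hmeas, hinv, hmass, hflux⟩ := h
  obtain ⟨C, hC⟩ := hstub G hsimple hnsc r β hβ hfs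
  have hδ1 : δ ≤ 1 - δ := (hmass 0).1.trans (hmass 0).2
  have hpos : 0 < δ * (1 - δ) := mul_pos hδ (by linarith)
  have hle : ∀ S : ℕ, δ * (1 - δ) ≤ C * ∑ ℓ : Edge 4 (2 * S + 1), ∫ U, ∫ g,
        ((A S).indicator (1 : GaugeConfig 4 (2 * S + 1) G → ℝ) U -
          (A S).indicator 1 (Function.update U ℓ g)) ^ 2
      ∂((haarProbability G).tilted (fun g' => -β * wilsonAction r.ρ (Function.update U ℓ g')))
      ∂(wilsonMeasure (d := 4) (L := 2 * S + 1) r.ρ β) := fun S => by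
    refine (mul_one_sub_le_mul_one_sub (hmass S).1 (hmass S).2).trans ?_
    rw [← variance_indicator_wilsonMeasure r β S (hmeas S)]
    exact hC S _ (measurable_one.indicator (hmeas S)) ⟨1, fun U => by
      by_cases hU : U ∈ A S <;> simp [Set.indicator, hU]⟩ (hinv S)
  have hlim := hflux.const_mul C
  rw [mul_zero] at hlim
  have : δ * (1 - δ) ≤ 0 := ge_of_tendsto hlim (Eventually.of_forall hle)
  linarith

end Summit.QuantumFields.YangMills.Theorems.SusceptibilityToPoincare.Negative
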